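import Summits.BirchSwinnertonDyer.Rank1Residual.O5.HeegnerLogTransportThree
import HarnessLib
import HarnessLib.Audit.Tags

/-!
# Heegner-log transport at `p = 3` (KL3), part 2 of 3: the chain's W-side PROVED modulo KL3-A — the log step (§2e), L1 at an additive prime (§2f), the composition (§2g) — o5-r2 GEN 16

Sibling of `O5/HeegnerLogTransportThree.lean` (part 1) and `O5/HeegnerLogTransportThreeTargets.lean` (part 3); same source `HOME/b2b-bsdres-o5-r2/gen16/lean/HeegnerLogTransportThree.lean` v7, sha16 `38be72b6cc6441f0` (701 l.; o5-r2 GEN 16's FILE OF RECORD, HOME/INBOX.md l.13174),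
§2e–§2g verbatim; split only for `lint.size`; typer of record cc-typer-5 GEN 17, docket cc-lead ⟦gen68⟧/⟦gen69⟧ (2′) (c31).  The module text of the source (the lever, the chain
(i)–(v), the ASSEMBLY-TODO with L1 / L2 / the log step DONE, sources [KrizLi2019] / [BCS2024] / [GrossLMS1991] / [BDP2013] / [Castella2018]) is in part 1 and
applies here verbatim.

HONEST FRAMING: everything below is PROVED bookkeeping (theorems, no `sorry`) modulo the ONE displayed hypothesis `hA : KrizLiUnitBitTransportThree`
(KL3-A = Kriz–Li Thm. 1.16 at `p = 3`, a theorem in print, typed in part 1 as a plain-def THEOREM-CANDIDATE and consumed only as a binder — no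
Literature fact is minted) and the displayed companion-side unit statement; research route, lane CLASS-CLOSURE §3.5 O5; nothing asserted beyond
the displayed binders, nothing booked, no RESIDUAL-MAP mark moves; census C-KL3-V = EVIDENCE only; O5 OPEN.  `@[conjecture]` × 0; 0 Literature facts.
-/


noncomputable section

open scoped Classical

open WeierstrassCurve Literature.NumberTheory.EllipticCurves
  Literature.NumberTheory.EllipticCurves.ModularForms
  Literature.NumberTheory.EllipticCurves.Rank1Residual
  Literature.NumberTheory.EllipticCurves.Rank1Residual.Typed

namespace Summit.BirchSwinnertonDyer.Rank1Residual.O5.HeegnerLogTransport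

open Summit.BirchSwinnertonDyer.Rank1Residual.X11b (padicLogOrd embAt padicPointOf)
open Summit.BirchSwinnertonDyer.Rank1Residual.X11b.LocalIndex (psi
  exists_addEquiv_valuation_psi_padicPointOf valuation_psi_zsmul_add)
open Literature.NumberTheory.EllipticCurves.Rank1Residual (Addv)
open Summit.BirchSwinnertonDyer.Rank1Residual.Additive.LocalLog (reductionPointCount_of_addv)
open Summit.BirchSwinnertonDyer.Rank1Residual.X11b.AcSelmer (selmerAcBase)
open IsDedekindDomain (HeightOneSpectrum)
open scoped NumberField

/-! ## §2e The LOG STEP of the chain, kernel-checked modulo KL3-A (items (ii)+(iv) of the ASSEMBLY-TODO):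
KL3-A + the companion-side unit statement (the conclusion of KL3-D) ⇒ `ord₃ log_{ω_W} P_W = 0` -/

/-- **The log step.** Assume KL3-A (Kriz–Li Thm. 1.16 at `p = 3`, `m = 1`, a theorem in print). Let `W`
be additive at `3` with `a₃(W) = 0` (so `|W̃^{ns}(𝔽₃)|/3 = 1`), `G` a mod-`3` companion, all depleted
Euler-type factors at `ℓ ≠ 3` units on both sides, both Manin constants prime to `3`, and suppose the
companion's Heegner log is a unit in Kriz–Li's normalisation (`U_G + ord₃ log P′ = 0`, which is what KL3-D
delivers). Then the Heegner log of `W` is a `3`-adic unit: `padicLogOrd W 3 ι₃ P = 0`. Pure bookkeeping over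
KL3-A — the substance is Kriz–Li's theorem and the companion-side input. [cite: KrizLi2019, Thm. 1.16, Rem. 1.17] -/
theorem padicLogOrd_eq_zero_of_companion_unit (hA : KrizLiUnitBitTransportThree)
    (W G : WeierstrassCurve ℚ) [W.IsElliptic] [W.IsGloballyMinimal] [G.IsElliptic] [G.IsGloballyMinimal]
    (hcong : ∀ ℓ : ℕ, ℓ.Prime → ¬ (ℓ ∣ 3 * W.conductorNorm ℤ * G.conductorNorm ℤ) →
      ((W.LFunction ℓ : ℤ) : ZMod 3) = ((G.LFunction ℓ : ℤ) : ZMod 3))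
    (hWbad : ¬ W.HasGoodReductionAtPrime 3) (hWa3 : W.LFunction 3 = 0)
    (hNW : W.conductorNorm ℤ ≠ 0) (hNG : G.conductorNorm ℤ ≠ 0)
    (hunitW : ∀ ℓ ∈ klSet W G, ℓ ≠ 3 → padicValInt 3 (nsCount W ℓ) = 0)
    (hunitG : ∀ ℓ ∈ klSet G W, ℓ ≠ 3 → padicValInt 3 (nsCount G ℓ) = 0)
    {N N' : ℕ} [NeZero N] [NeZero N'] (D : ModularParametrizationData W N)
    (D' : ModularParametrizationData G N')
    (K : Type) [Field K] [NumberField K] (hK : IsImaginaryQuadratic K)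
    (hH : SatisfiesHeegnerHypothesis N K) (hH' : SatisfiesHeegnerHypothesis N' K)
    (hd : NumberField.discr K < -4) (h3d : ¬ ((3 : ℤ) ∣ NumberField.discr K))
    (H : HeegnerDatum N (NumberField.discr K)) (H' : HeegnerDatum N' (NumberField.discr K))
    (ι : K →+* ℂ) (ι₃ : K →+* ℚ_[3])
    (P : (W.baseChange K).toAffine.Point) (P' : (G.baseChange K).toAffine.Point)
    (hP : WeierstrassCurve.Affine.Point.map ι.toRatAlgHom P = heegnerPointComplex D H)
    (hP' : WeierstrassCurve.Affine.Point.map ι.toRatAlgHom P' = heegnerPointComplex D' H')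
    (hPinf : ¬ IsOfFinAddOrder P) (hP'inf : ¬ IsOfFinAddOrder P')
    (hcD : padicValInt 3 D.maninConstant = 0) (hcD' : padicValInt 3 D'.maninConstant = 0)
    (hGunit : padicLogOrd G 3 ι₃ P' + padicValInt 3 (nsCount G 3) - 1 = 0) :
    padicLogOrd W 3 ι₃ P = 0 := by
  have hiff := hA W G hcong D D' K hK hH hH' hd h3d H H' ι ι₃ P P' hP hP' hPinf hP'inf
  have hUW : klExponent W G = 0 :=
    klExponent_eq_zero_of_units W G (padicValInt_nsCount_three_of_additive W hWbad hWa3) hunitW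
  have hUG : klExponent G W = padicValInt 3 (nsCount G 3) - 1 :=
    klExponent_eq_of_offThree_units G W (three_mem_klSet G W hNG hNW) hunitG
  have hR : klExponent G W + padicLogOrd G 3 ι₃ P' - padicValInt 3 D'.maninConstant = 0 := by
    rw [hUG, hcD']; push_cast; linarith
  have hL := hiff.mpr hR
  rw [hUW, hcD] at hL
  push_cast at hL
  linarith

/-! ## §2f L1 of the ASSEMBLY-TODO, PROVED: `ord₃ log_ω P = 0 ⇒ 3 ∤ [E(K) : ℤP]` at an ADDITIVE prime
((iv)-free locally; globally under `E(K)[3] = 0`). The local index machinery is X11b's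
(`BDPRouteLocalIndex` / `BDPRouteLocalIndexTorsion`, Castella 2018 (calcul) / JSW17 (7.1.5) on tree objects):
the `ℤ₃`-coordinate `Ψ(P_ι)` has valuation `padicLogOrd + ord₃ c₃ + ord₃ #Ẽ_ns(𝔽₃) − 1`, and at an additive
prime `#Ẽ_ns(𝔽₃) = 3` (`reductionPointCount_of_addv`), so with a 3-unit `c₃` (Kodaira III, III*: `c₃ = 2`)
the exponent is `padicLogOrd` itself. -/

section L1

variable (W : WeierstrassCurve ℚ) [W.IsElliptic] [W.IsGloballyMinimal] (p : ℕ) [Fact p.Prime]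
  {K : Type} [Field K] [NumberField K]

omit [W.IsElliptic] [W.IsGloballyMinimal] in
/-- `P ∈ E(K)` of infinite order stays of infinite order in `E(ℚ_p)` along any embedding
(`Point.map` along a field hom is an injective group hom) — part of the L3 bookkeeping. [folklore] -/
theorem not_isOfFinAddOrder_padicPointOf (ι : K →+* ℚ_[p]) (P : (W.baseChange K).toAffine.Point)
    (hP : ¬ IsOfFinAddOrder P) : ¬ IsOfFinAddOrder (padicPointOf W p ι P) := by
  intro h
  apply hP
  obtain ⟨n, hn, hnP⟩ := (isOfFinAddOrder_iff_nsmul_eq_zero).mp h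
  refine (isOfFinAddOrder_iff_nsmul_eq_zero).mpr ⟨n, hn, ?_⟩
  apply WeierstrassCurve.Affine.Point.map_injective (f := ι.toRatAlgHom)
  rw [map_nsmul, map_zero]
  exact hnP

/-- **L1, local form ((iv)-free).** At a prime `p` where the Tamagawa number `c_p` is a `p`-unit and
`ord_p #Ẽ_ns(𝔽_p) = 1` (every ADDITIVE prime: `#Ẽ_ns(𝔽_p) = p`, `reductionPointCount_of_addv`), a point
`P ∈ E(K)` whose Néron-normalised `p`-adic log order `padicLogOrd W p ι P` vanishes (and whose image
`P_ι ∈ E(ℚ_p)` has infinite order) is NOT a `p`-th multiple in `E(ℚ_p)`: the `ℤ_p`-coordinate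
`Ψ(P_ι)` has valuation `padicLogOrd + ord_p c_p + ord_p #Ẽ_ns − 1 = 0`
(`exists_addEquiv_valuation_psi_padicPointOf`), while `Ψ(p • Q) = p Ψ(Q)` has valuation `≥ 1`
(`valuation_psi_zsmul_add`). [cite: Castella2018, proof of Thm. 2.3, (calcul) (arXiv:1704.06608 p. 6)]
[cite: JetchevSkinnerWan2017, (7.1.5) (arXiv:1512.06894 p. 16)] -/
theorem padicPointOf_ne_nsmul_of_padicLogOrd_eq_zero (ι : K →+* ℚ_[p])
    (P : (W.baseChange K).toAffine.Point) (hP : ¬ IsOfFinAddOrder (padicPointOf W p ι P))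
    (hc : ¬ p ∣ (W.baseChange ℚ_[p]).localTamagawaNumber ℤ_[p])
    (hns : padicValNat p (reductionPointCount W p) = 1)
    (hlog : padicLogOrd W p ι P = 0) (Q : (W.baseChange ℚ_[p]).toAffine.Point) :
    p • Q ≠ padicPointOf W p ι P := by
  haveI : ((W.baseChange ℚ_[p]).formalFiltration 2).FiniteIndex :=
    (W.baseChange ℚ_[p]).finiteIndex_formalFiltration 2
  obtain ⟨φ, hφ⟩ := exists_addEquiv_valuation_psi_padicPointOf W p (K := K)
  intro hQ
  have hv0 : ((psi ((W.baseChange ℚ_[p]).formalFiltration 2) φ (padicPointOf W p ι P)).valuation : ℤ)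
      = 0 := by
    rw [hφ ι P hP, hlog, padicValNat.eq_zero_of_not_dvd hc, hns]; norm_num
  have hQinf : ¬ IsOfFinAddOrder Q := by
    intro h
    apply hP
    rw [← hQ]
    exact h.nsmul
  have hp0 : ((p : ℕ) : ℤ) ≠ 0 := by exact_mod_cast (Fact.out : p.Prime).ne_zero
  have ht : IsOfFinAddOrder (0 : (W.baseChange ℚ_[p]).toAffine.Point) :=
    (isOfFinAddOrder_iff_nsmul_eq_zero).mpr ⟨1, one_pos, by simp⟩
  have h1 := valuation_psi_zsmul_add ((W.baseChange ℚ_[p]).formalFiltration 2) φ hQinf ht hp0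
  have h2 : ((p : ℕ) : ℤ) • Q + 0 = padicPointOf W p ι P := by rw [add_zero, natCast_zsmul, hQ]
  rw [h2] at h1
  have h3 : padicValNat p (((p : ℕ) : ℤ).natAbs) = 1 := by simp
  rw [h3] at h1
  have h4 : (psi ((W.baseChange ℚ_[p]).formalFiltration 2) φ (padicPointOf W p ι P)).valuation = 0 := by
    exact_mod_cast hv0
  omega

/-- **L1 at an ADDITIVE prime, in T-O5-B's vocabulary**: `Addv W p` gives `#Ẽ_ns(𝔽_p) = p`
(`reductionPointCount_of_addv`), so with a `p`-unit Tamagawa number at `p` (Kodaira III, III*: `c_p = 2`)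
a point of log order `0` is not a `p`-th multiple of any `K`-rational point either. [folklore] -/
theorem not_nsmul_eq_of_padicLogOrd_eq_zero_of_addv (hadd : Addv W p) (ι : K →+* ℚ_[p])
    (P : (W.baseChange K).toAffine.Point) (hP : ¬ IsOfFinAddOrder (padicPointOf W p ι P))
    (hc : ¬ p ∣ (W.baseChange ℚ_[p]).localTamagawaNumber ℤ_[p])
    (hlog : padicLogOrd W p ι P = 0) (Q : (W.baseChange K).toAffine.Point) :
    p • Q ≠ P := by
  intro hQ
  have hns : padicValNat p (reductionPointCount W p) = 1 := by
    rw [reductionPointCount_of_addv W p hadd]; simp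
  apply padicPointOf_ne_nsmul_of_padicLogOrd_eq_zero W p ι P hP hc hns hlog (padicPointOf W p ι Q)
  rw [← hQ]
  unfold padicPointOf
  exact (map_nsmul _ _ _).symm

/-! ### §2f (continued) — L1, global step: pure algebra -/

/-- In an abelian group without `p`-torsion, an element that is not a `p`-th multiple generates a
subgroup of index prime to `p` (index `0` = infinite allowed: `padicValNat p 0 = 0`). Cauchy's theorem in
the finite quotient. [folklore] -/
theorem padicValNat_index_zmultiples_eq_zero {A : Type*} [AddCommGroup A] {q : ℕ} [hq : Fact q.Prime]
    (hA : ∀ R : A, q • R = 0 → R = 0) {P : A} (hP : ∀ Q : A, q • Q ≠ P) :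
    padicValNat q (AddSubgroup.zmultiples P).index = 0 := by
  classical
  set H := AddSubgroup.zmultiples P with hH
  by_cases h0 : H.index = 0
  · rw [h0]; simp
  apply padicValNat.eq_zero_of_not_dvd
  intro hdvd
  haveI : H.FiniteIndex := ⟨h0⟩
  haveI : Finite (A ⧸ H) := AddSubgroup.finite_quotient_of_finiteIndex
  have hcard : q ∣ Nat.card (A ⧸ H) := hdvd
  obtain ⟨x, hx⟩ := exists_prime_addOrderOf_dvd_card' q hcard
  obtain ⟨y, rfl⟩ := QuotientAddGroup.mk_surjective x
  have hqy : q • y ∈ H := by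
    rw [← QuotientAddGroup.eq_zero_iff, QuotientAddGroup.mk_nsmul, ← hx, addOrderOf_nsmul_eq_zero]
  have hy : y ∉ H := by
    intro h
    have h1 : (QuotientAddGroup.mk y : A ⧸ H) = 0 := (QuotientAddGroup.eq_zero_iff y).mpr h
    rw [h1, addOrderOf_zero] at hx
    exact hq.out.one_lt.ne hx
  obtain ⟨k, hk⟩ := AddSubgroup.mem_zmultiples_iff.mp hqy
  by_cases hqk : (q : ℤ) ∣ k
  · obtain ⟨j, rfl⟩ := hqk
    have h2 : q • (y - j • P) = 0 := by
      rw [nsmul_sub, ← natCast_zsmul (j • P) q, smul_smul, hk, sub_self]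
    have hyj := hA _ h2
    rw [sub_eq_zero] at hyj
    exact hy (hyj ▸ AddSubgroup.zsmul_mem _ (AddSubgroup.mem_zmultiples P) j)
  · have hirr : Irreducible (q : ℤ) := (Nat.prime_iff_prime_int.mp hq.out).irreducible
    obtain ⟨a, b, hab⟩ := (hirr.coprime_iff_not_dvd.mpr hqk)
    have hqy' : (q : ℤ) • y = k • P := by rw [natCast_zsmul]; exact hk.symm
    apply hP (a • P + b • y)
    rw [← natCast_zsmul, zsmul_add, smul_smul, smul_smul, mul_comm (q : ℤ) b, ← smul_smul b (q : ℤ) y,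
      hqy', smul_smul, ← add_zsmul, show (q : ℤ) * a + b * k = 1 by linarith [hab], one_zsmul]

/-- **L1 assembled (additive prime, route currency).** For `W/ℚ` globally minimal, additive at `p`
with a `p`-unit local Tamagawa number, `E(K)` without `p`-torsion, and `P ∈ E(K)` whose image in
`E(ℚ_p)` has infinite order and whose Néron log order vanishes: `p ∤ [E(K) : ℤP]`. [folklore] -/
theorem padicValNat_index_eq_zero_of_padicLogOrd_eq_zero (hadd : Addv W p) (ι : K →+* ℚ_[p])
    (P : (W.baseChange K).toAffine.Point) (hP : ¬ IsOfFinAddOrder P)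
    (hc : ¬ p ∣ (W.baseChange ℚ_[p]).localTamagawaNumber ℤ_[p])
    (htors : ∀ R : (W.baseChange K).toAffine.Point, p • R = 0 → R = 0)
    (hlog : padicLogOrd W p ι P = 0) :
    padicValNat p (AddSubgroup.zmultiples P).index = 0 :=
  padicValNat_index_zmultiples_eq_zero htors
    (not_nsmul_eq_of_padicLogOrd_eq_zero_of_addv W p hadd ι P
      (not_isOfFinAddOrder_padicPointOf W p ι P hP) hc hlog)

end L1

/-! ## §2g The chain's W-side, composed: KL3-A + companion-side unit ⇒ `3 ∤ [W(K) : ℤP_W]` (§2e + §2f) -/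

/-- **Log step + L1, composed (kernel-checked modulo KL3-A).** Under the hypotheses of
`padicLogOrd_eq_zero_of_companion_unit` (KL3-A, a mod-3 companion `G` whose Heegner log is a unit in
Kriz–Li's normalisation, off-3 depletion factors and Manin constants units) and additionally `Addv W 3`,
a 3-unit local Tamagawa number of `W` at 3 and `W(K)[3] = 0`:
`ord₃ [W(K) : ℤP] = 0`. What remains between this and KL3-C♭ is only the COMPANION-side input
(KL3-B/M → KL3-D) and L3 (`ι₃ = embAt`). [cite: KrizLi2019, Thm. 1.16, Rem. 1.17]
[cite: Castella2018, proof of Thm. 2.3, (calcul) (arXiv:1704.06608 p. 6)] -/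
theorem padicValNat_index_eq_zero_of_companion_unit (hA : KrizLiUnitBitTransportThree)
    (W G : WeierstrassCurve ℚ) [W.IsElliptic] [W.IsGloballyMinimal] [G.IsElliptic] [G.IsGloballyMinimal]
    (hcong : ∀ ℓ : ℕ, ℓ.Prime → ¬ (ℓ ∣ 3 * W.conductorNorm ℤ * G.conductorNorm ℤ) →
      ((W.LFunction ℓ : ℤ) : ZMod 3) = ((G.LFunction ℓ : ℤ) : ZMod 3))
    (hadd : Addv W 3) (hWa3 : W.LFunction 3 = 0)
    (hNW : W.conductorNorm ℤ ≠ 0) (hNG : G.conductorNorm ℤ ≠ 0)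
    (hunitW : ∀ ℓ ∈ klSet W G, ℓ ≠ 3 → padicValInt 3 (nsCount W ℓ) = 0)
    (hunitG : ∀ ℓ ∈ klSet G W, ℓ ≠ 3 → padicValInt 3 (nsCount G ℓ) = 0)
    (hc3 : ¬ 3 ∣ (W.baseChange ℚ_[3]).localTamagawaNumber ℤ_[3])
    {N N' : ℕ} [NeZero N] [NeZero N'] (D : ModularParametrizationData W N)
    (D' : ModularParametrizationData G N')
    (K : Type) [Field K] [NumberField K] (hK : IsImaginaryQuadratic K)
    (hH : SatisfiesHeegnerHypothesis N K) (hH' : SatisfiesHeegnerHypothesis N' K)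
    (hd : NumberField.discr K < -4) (h3d : ¬ ((3 : ℤ) ∣ NumberField.discr K))
    (htors : ∀ R : (W.baseChange K).toAffine.Point, 3 • R = 0 → R = 0)
    (H : HeegnerDatum N (NumberField.discr K)) (H' : HeegnerDatum N' (NumberField.discr K))
    (ι : K →+* ℂ) (ι₃ : K →+* ℚ_[3])
    (P : (W.baseChange K).toAffine.Point) (P' : (G.baseChange K).toAffine.Point)
    (hP : WeierstrassCurve.Affine.Point.map ι.toRatAlgHom P = heegnerPointComplex D H)
    (hP' : WeierstrassCurve.Affine.Point.map ι.toRatAlgHom P' = heegnerPointComplex D' H')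
    (hPinf : ¬ IsOfFinAddOrder P) (hP'inf : ¬ IsOfFinAddOrder P')
    (hcD : padicValInt 3 D.maninConstant = 0) (hcD' : padicValInt 3 D'.maninConstant = 0)
    (hGunit : padicLogOrd G 3 ι₃ P' + padicValInt 3 (nsCount G 3) - 1 = 0) :
    padicValNat 3 (AddSubgroup.zmultiples P).index = 0 :=
  padicValNat_index_eq_zero_of_padicLogOrd_eq_zero W 3 hadd ι₃ P hPinf hc3 htors
    (padicLogOrd_eq_zero_of_companion_unit hA W G hcong hadd.1 hWa3 hNW hNG hunitW hunitG D D' K hK hH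
      hH' hd h3d H H' ι ι₃ P P' hP hP' hPinf hP'inf hcD hcD' hGunit)

end Summit.BirchSwinnertonDyer.Rank1Residual.O5.HeegnerLogTransport

end
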